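import Literature.Probability.Percolation.MarkedLoopRelinkIndex
import Literature.Probability.Percolation.MarkedLoopBoundarySpan
import HarnessLib

/-!
# The five-marked unit hexagon: three further markings, corner faces, bond universe, and five home-arc lawpoints («HEXAGON-LAWPOINTS»)

Topic `Literature/Probability/Percolation`; generic-`k` layer of the marked-loop (Khristoforov–Smirnov) lineage at `k = 5`. Bookkeeping for the lane's
census certificate of BOUNDARY SPAN at five marks (`MarkedLoopBoundarySpanDeterminant.lean`: five home-arc lawpoints whose `5 × 5` matrix of
boundary pattern counts is non-singular ⇒ `BSpan 5`). The seven-site hexagon `triBall 1` (Bollobás–Riordan marked discrete domain; tree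
`hexBall1Five` of `TriHexBallDomain.lean`: base dart `((1,0),(2,0))`, marks at positions `0, 3, 6, 9, 12` of the 18-dart boundary cycle — every one of
its six boundary sites is markable, at positions `0, 3, 6, 9, 12, 15`) carries FOUR more five-markings with the same base; three of them are needed:

* `hexBall1FiveW`, `hexBall1FiveNW`, `hexBall1FiveNE : TriMarkedDomain 5` — marks at positions `{0,3,6,12,15}`, `{0,3,9,12,15}`, `{0,6,9,12,15}`, i.e. the
  unmarked boundary site is the western `(−1,0)`, the north-western `(−1,1)`, the north-eastern `(0,1)` neighbour of the origin (for `hexBall1Five` it is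
  the south-eastern `(1,−1)`); all thirteen proof fields are those of `hexBall1Five` (same sites, same base) or `decide`;
* the CORNER FACES of the three new markings tabulated and identified with the tree's `yc` (`yc_hexBall1FiveW`, …; for `hexBall1Five` the tree's `FivePoint.S0.cornerT` /
  `yc_hexBall1Five` of `MarkedLoopRelinkIndex.lean`), the corner sets;
* `hexBall1Bonds` — the explicit universe of the bonds of `H_G` (the six bonds at each of the seven sites; `mem_hexBall1Bonds`);
* ★ FIVE HOME-ARC LAWPOINTS `zHexA, zHexB : ArcPoint hexBall1Five (Fin.last 4)`, `zHexC : ArcPoint hexBall1FiveW (Fin.last 4)`, `zHexD : ArcPoint hexBall1FiveNW (Fin.last 4)`,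
  `zHexE : ArcPoint hexBall1FiveNE (Fin.last 4)` — boundary mid-edges on the arc `A_4` from `u_5` to `u_1` read at a face with three `H_G`-sides: `zHexA` on the dart
  `((0,−1),(1,−2))` and `zHexB` on `((1,−1),(1,−2))` of the long home arc of `hexBall1Five` (through the unmarked site `(1,−1)`), `zHexC, zHexD, zHexE` on the dart `((1,−1),(2,−1))`
  of the one-site home arcs of the other three (all fields by `decide`).

The lane's author-side enumeration (HOME `pub-sawmu-b-engine-2/gen27/bspan5/`) finds the boundary laws of these five lawpoints linearly independent
(determinant `−226 304`); the kernel censuses are `MarkedLoopHexagonCensusA…E.lean`, the assembly `MarkedLoopBoundarySpanFive.lean`. No mathematics beyond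
finite checks here.

## References
* B. Bollobás, O. Riordan, *Percolation*, Cambridge University Press (2006), Ch. 7 §7.2.2 (pp. 168–169: marked discrete domains, marks at the second outside
  neighbour; pp. 191–195: the arcs).
* M. Khristoforov, S. Smirnov, *Percolation and O(1) loop model*, arXiv:2111.15612 (2021), §1.2 (arXiv v1 pp. 2–3: the half-edges of `Ω`, the disorders),
  §2 eq. (4) and Remark 6 (p. 5: boundary values on the arc `u_{j−1}u_{j+1}`).

## Mathlib / tree
Tree: `TriHexBallDomain.lean` (`hexBall1Five`, `hexBall1Base`, `triBall`), `MarkedLoopRelinkIndex.lean` (`yc_hexBall1Five`), `FiveMarkedS0HexBall1.lean` (`FivePoint.S0.cornerT`),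
`MarkedLoopBoundarySpan.lean` (`ArcPoint`), `KhSThreeDisorderObservable.lean` (`AllSides`),
`MarkedLoopSpace.lean` (`IsCornerFace`, `yc`, `isCornerFace_iff_eq_yc`, `corners`, `mem_hBonds`), `TriDiscShelling.lean` (`triDir`). Mathlib: `decide`.
-/

open Finset

namespace Literature.Probability.Percolation.MarkedLoops

open Literature.Probability.Percolation Literature.Probability.LatticeModels
open Literature.Probability.Percolation.FivePoint (xiDeg XiLinked side)
open TriMarkedDomain

set_option maxRecDepth 400000
/-! ### Three further five-markings of the unit hexagon -/
/-- the positions `0, 3, 6, 12, 15` of the marked darts along the 18-dart boundary cycle. [cite: BollobasRiordan2006, Ch. 7 §7.2.2 pp. 168–169] -/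
def hexBall1FiveWPos : Fin 5 → ℕ := ![0, 3, 6, 12, 15]

/-- **the five-marked unit hexagon with the western site `(-1,0)` unmarked**: sites `triBall 1`, base dart `((1,0),(2,0))`, marks at
positions `0, 3, 6, 12, 15`, i.e. at the sites `(1,0), (0,1), (-1,1), (0,-1), (1,-1)` (anticlockwise), each marked at its second outside neighbour. [cite: BollobasRiordan2006, Ch. 7 §7.2.2 pp. 168–169] -/
noncomputable def hexBall1FiveW : TriMarkedDomain 5 where
  verts := triBall 1
  base := hexBall1Base
  pos := hexBall1FiveWPos
  base_mem := hexBall1Five.base_mem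
  connected := hexBall1Five.connected
  outer_connected := hexBall1Five.outer_connected
  no_cut := hexBall1Five.no_cut
  outer_no_cut := hexBall1Five.outer_no_cut
  euler := hexBall1Five.euler
  cycle := hexBall1Five.cycle
  cycle_len := hexBall1Five.cycle_len
  pos_zero := fun _ => rfl
  pos_strictMono := by
    intro a b hab
    revert a b
    decide
  pos_lt := by decide
  mark_pred := by decide
  mark_pred_pred := by decide
  mark_injective := by
    intro a b hab
    revert a b
    decide

/-- the site set. [cite: BollobasRiordan2006, Ch. 7 §7.2.2 pp. 168–169] -/
@[simp] theorem hexBall1FiveW_verts : hexBall1FiveW.verts = triBall 1 := rfl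

/-- the marked sites, tabulated. [cite: BollobasRiordan2006, Ch. 7 §7.2.2 pp. 168–169] -/
theorem hexBall1FiveW_markSite : ∀ i : Fin 5, hexBall1FiveW.markSite i = (![![1, 0], ![0, 1], ![-1, 1], ![0, -1], ![1, -1]] : Fin 5 → Site 2) i := by
  decide

/-- the positions `0, 3, 9, 12, 15` of the marked darts along the 18-dart boundary cycle. [cite: BollobasRiordan2006, Ch. 7 §7.2.2 pp. 168–169] -/
def hexBall1FiveNWPos : Fin 5 → ℕ := ![0, 3, 9, 12, 15]

/-- **the five-marked unit hexagon with the north-western site `(-1,1)` unmarked**: sites `triBall 1`, base dart `((1,0),(2,0))`, marks at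
positions `0, 3, 9, 12, 15`, i.e. at the sites `(1,0), (0,1), (-1,0), (0,-1), (1,-1)` (anticlockwise), each marked at its second outside neighbour. [cite: BollobasRiordan2006, Ch. 7 §7.2.2 pp. 168–169] -/
noncomputable def hexBall1FiveNW : TriMarkedDomain 5 where
  verts := triBall 1
  base := hexBall1Base
  pos := hexBall1FiveNWPos
  base_mem := hexBall1Five.base_mem
  connected := hexBall1Five.connected
  outer_connected := hexBall1Five.outer_connected
  no_cut := hexBall1Five.no_cut
  outer_no_cut := hexBall1Five.outer_no_cut
  euler := hexBall1Five.euler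
  cycle := hexBall1Five.cycle
  cycle_len := hexBall1Five.cycle_len
  pos_zero := fun _ => rfl
  pos_strictMono := by
    intro a b hab
    revert a b
    decide
  pos_lt := by decide
  mark_pred := by decide
  mark_pred_pred := by decide
  mark_injective := by
    intro a b hab
    revert a b
    decide

/-- the site set. [cite: BollobasRiordan2006, Ch. 7 §7.2.2 pp. 168–169] -/
@[simp] theorem hexBall1FiveNW_verts : hexBall1FiveNW.verts = triBall 1 := rfl

/-- the marked sites, tabulated. [cite: BollobasRiordan2006, Ch. 7 §7.2.2 pp. 168–169] -/
theorem hexBall1FiveNW_markSite : ∀ i : Fin 5, hexBall1FiveNW.markSite i = (![![1, 0], ![0, 1], ![-1, 0], ![0, -1], ![1, -1]] : Fin 5 → Site 2) i := by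
  decide

/-- the positions `0, 6, 9, 12, 15` of the marked darts along the 18-dart boundary cycle. [cite: BollobasRiordan2006, Ch. 7 §7.2.2 pp. 168–169] -/
def hexBall1FiveNEPos : Fin 5 → ℕ := ![0, 6, 9, 12, 15]

/-- **the five-marked unit hexagon with the north-eastern site `(0,1)` unmarked**: sites `triBall 1`, base dart `((1,0),(2,0))`, marks at
positions `0, 6, 9, 12, 15`, i.e. at the sites `(1,0), (-1,1), (-1,0), (0,-1), (1,-1)` (anticlockwise), each marked at its second outside neighbour. [cite: BollobasRiordan2006, Ch. 7 §7.2.2 pp. 168–169] -/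
noncomputable def hexBall1FiveNE : TriMarkedDomain 5 where
  verts := triBall 1
  base := hexBall1Base
  pos := hexBall1FiveNEPos
  base_mem := hexBall1Five.base_mem
  connected := hexBall1Five.connected
  outer_connected := hexBall1Five.outer_connected
  no_cut := hexBall1Five.no_cut
  outer_no_cut := hexBall1Five.outer_no_cut
  euler := hexBall1Five.euler
  cycle := hexBall1Five.cycle
  cycle_len := hexBall1Five.cycle_len
  pos_zero := fun _ => rfl
  pos_strictMono := by
    intro a b hab
    revert a b
    decide
  pos_lt := by decide
  mark_pred := by decide
  mark_pred_pred := by decide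
  mark_injective := by
    intro a b hab
    revert a b
    decide

/-- the site set. [cite: BollobasRiordan2006, Ch. 7 §7.2.2 pp. 168–169] -/
@[simp] theorem hexBall1FiveNE_verts : hexBall1FiveNE.verts = triBall 1 := rfl

/-- the marked sites, tabulated. [cite: BollobasRiordan2006, Ch. 7 §7.2.2 pp. 168–169] -/
theorem hexBall1FiveNE_markSite : ∀ i : Fin 5, hexBall1FiveNE.markSite i = (![![1, 0], ![-1, 1], ![-1, 0], ![0, -1], ![1, -1]] : Fin 5 → Site 2) i := by
  decide

/-! ### Corner faces of the four markings (for `hexBall1Five` the tree's table `FivePoint.S0.cornerT` and `yc_hexBall1Five` of `MarkedLoopRelinkIndex.lean`) -/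
/-- the corner set of `hexBall1Five`, tabulated. [cite: BollobasRiordan2006, Ch. 7 §7.2.2 pp. 168–169] -/
theorem corners_hexBall1Five : corners hexBall1Five = (Finset.univ : Finset (Fin 5)).image FivePoint.S0.cornerT := by
  unfold corners
  exact Finset.image_congr fun j _ => yc_hexBall1Five j

/-- the corner faces `y_0, …, y_4` of `hexBall1FiveW`, tabulated (the outer face at each marked site spanned by the heads of the marked dart and of its predecessor).
[cite: BollobasRiordan2006, Ch. 7 §7.2.2 pp. 168–169] -/
def hexCornerW : Fin 5 → HexVertex := ![(![1, -1], 1), (![0, 1], 0), (![-2, 1], 1), (![-1, -2], 1), (![1, -2], 0)]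

/-- the tabulated faces ARE the corner faces. [cite: BollobasRiordan2006, Ch. 7 §7.2.2 pp. 168–169] -/
theorem isCornerFace_hexCornerW (j : Fin 5) : IsCornerFace hexBall1FiveW j (hexCornerW j) := by
  revert j
  unfold IsCornerFace predDart
  decide

/-- `yc hexBall1FiveW = hexCornerW`. [cite: BollobasRiordan2006, Ch. 7 §7.2.2 pp. 168–169] -/
theorem yc_hexBall1FiveW (j : Fin 5) : yc hexBall1FiveW j = hexCornerW j :=
  ((isCornerFace_iff_eq_yc hexBall1FiveW).1 (isCornerFace_hexCornerW j)).symm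

/-- the corner set of `hexBall1FiveW`, tabulated. [cite: BollobasRiordan2006, Ch. 7 §7.2.2 pp. 168–169] -/
theorem corners_hexBall1FiveW : corners hexBall1FiveW = (Finset.univ : Finset (Fin 5)).image hexCornerW := by
  unfold corners
  exact Finset.image_congr fun j _ => yc_hexBall1FiveW j

/-- the corner faces `y_0, …, y_4` of `hexBall1FiveNW`, tabulated (the outer face at each marked site spanned by the heads of the marked dart and of its predecessor).
[cite: BollobasRiordan2006, Ch. 7 §7.2.2 pp. 168–169] -/
def hexCornerNW : Fin 5 → HexVertex := ![(![1, -1], 1), (![0, 1], 0), (![-2, 0], 0), (![-1, -2], 1), (![1, -2], 0)]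

/-- the tabulated faces ARE the corner faces. [cite: BollobasRiordan2006, Ch. 7 §7.2.2 pp. 168–169] -/
theorem isCornerFace_hexCornerNW (j : Fin 5) : IsCornerFace hexBall1FiveNW j (hexCornerNW j) := by
  revert j
  unfold IsCornerFace predDart
  decide

/-- `yc hexBall1FiveNW = hexCornerNW`. [cite: BollobasRiordan2006, Ch. 7 §7.2.2 pp. 168–169] -/
theorem yc_hexBall1FiveNW (j : Fin 5) : yc hexBall1FiveNW j = hexCornerNW j :=
  ((isCornerFace_iff_eq_yc hexBall1FiveNW).1 (isCornerFace_hexCornerNW j)).symm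

/-- the corner set of `hexBall1FiveNW`, tabulated. [cite: BollobasRiordan2006, Ch. 7 §7.2.2 pp. 168–169] -/
theorem corners_hexBall1FiveNW : corners hexBall1FiveNW = (Finset.univ : Finset (Fin 5)).image hexCornerNW := by
  unfold corners
  exact Finset.image_congr fun j _ => yc_hexBall1FiveNW j

/-- the corner faces `y_0, …, y_4` of `hexBall1FiveNE`, tabulated (the outer face at each marked site spanned by the heads of the marked dart and of its predecessor).
[cite: BollobasRiordan2006, Ch. 7 §7.2.2 pp. 168–169] -/
def hexCornerNE : Fin 5 → HexVertex := ![(![1, -1], 1), (![-2, 1], 1), (![-2, 0], 0), (![-1, -2], 1), (![1, -2], 0)]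

/-- the tabulated faces ARE the corner faces. [cite: BollobasRiordan2006, Ch. 7 §7.2.2 pp. 168–169] -/
theorem isCornerFace_hexCornerNE (j : Fin 5) : IsCornerFace hexBall1FiveNE j (hexCornerNE j) := by
  revert j
  unfold IsCornerFace predDart
  decide

/-- `yc hexBall1FiveNE = hexCornerNE`. [cite: BollobasRiordan2006, Ch. 7 §7.2.2 pp. 168–169] -/
theorem yc_hexBall1FiveNE (j : Fin 5) : yc hexBall1FiveNE j = hexCornerNE j :=
  ((isCornerFace_iff_eq_yc hexBall1FiveNE).1 (isCornerFace_hexCornerNE j)).symm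

/-- the corner set of `hexBall1FiveNE`, tabulated. [cite: BollobasRiordan2006, Ch. 7 §7.2.2 pp. 168–169] -/
theorem corners_hexBall1FiveNE : corners hexBall1FiveNE = (Finset.univ : Finset (Fin 5)).image hexCornerNE := by
  unfold corners
  exact Finset.image_congr fun j _ => yc_hexBall1FiveNE j

/-! ### The bond universe and the touching faces of the hexagon, as explicit finsets -/

/-- **the bond universe of the unit hexagon**: the six bonds of `𝕋` at each site of `triBall 1` (30 bonds; an explicit finset containing `hBonds`). [cite: KhristoforovSmirnov2021, §1.2 (arXiv v1 pp. 2–3)] -/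
def hexBall1Bonds : Finset (Sym2 (Site 2)) :=
  {s(![-2, 0], ![-1, 0]), s(![-2, 1], ![-1, 0]), s(![-2, 1], ![-1, 1]), s(![-2, 2], ![-1, 1]), s(![-1, -1], ![-1, 0]), s(![-1, -1], ![0, -1]),
   s(![-1, 0], ![-1, 1]), s(![-1, 0], ![0, -1]), s(![-1, 0], ![0, 0]), s(![-1, 1], ![-1, 2]), s(![-1, 1], ![0, 0]), s(![-1, 1], ![0, 1]),
   s(![-1, 2], ![0, 1]), s(![0, -2], ![0, -1]), s(![0, -1], ![0, 0]), s(![0, -1], ![1, -2]), s(![0, -1], ![1, -1]), s(![0, 0], ![0, 1]),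
   s(![0, 0], ![1, -1]), s(![0, 0], ![1, 0]), s(![0, 1], ![0, 2]), s(![0, 1], ![1, 0]), s(![0, 1], ![1, 1]), s(![1, -2], ![1, -1]),
   s(![1, -1], ![1, 0]), s(![1, -1], ![2, -2]), s(![1, -1], ![2, -1]), s(![1, 0], ![1, 1]), s(![1, 0], ![2, -1]), s(![1, 0], ![2, 0])}

/-- every bond at a site of the hexagon is in the universe (for any marking of `triBall 1`; finite check). [cite: KhristoforovSmirnov2021, §1.2 (arXiv v1 pp. 2–3)] -/
theorem mem_hexBall1Bonds {D : TriMarkedDomain 5} (hD : D.verts = triBall 1) : ∀ u ∈ D.verts, ∀ j : Fin 6, s(u, u + triDir j) ∈ hexBall1Bonds := by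
  rw [hD]
  decide

/-- **the 24 faces of `𝕋` touching the unit hexagon**, as an explicit finset. [cite: BollobasRiordan2006, Ch. 7 Lemma 12 (pp. 206–207)] -/
def hexBall1Faces : Finset HexVertex :=
  {(![-2, -1], 1), (![-2, 0], 0), (![-2, 0], 1), (![-2, 1], 0), (![-2, 1], 1), (![-1, -2], 1), (![-1, -1], 0), (![-1, -1], 1),
   (![-1, 0], 0), (![-1, 0], 1), (![-1, 1], 0), (![-1, 1], 1), (![0, -2], 0), (![0, -2], 1), (![0, -1], 0), (![0, -1], 1),
   (![0, 0], 0), (![0, 0], 1), (![0, 1], 0), (![1, -2], 0), (![1, -2], 1), (![1, -1], 0), (![1, -1], 1), (![1, 0], 0)}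

/-- the explicit finset IS `triFacesTouching (triBall 1)` (finite check). [cite: BollobasRiordan2006, Ch. 7 Lemma 12 (pp. 206–207)] -/
theorem triFacesTouching_hexBall1 : triFacesTouching (triBall 1) = hexBall1Faces := by
  decide

/-- a face touching the sites of any marking of the hexagon is one of the 24. [cite: BollobasRiordan2006, Ch. 7 Lemma 12 (pp. 206–207)] -/
theorem mem_hexBall1Faces_of_touching {D : TriMarkedDomain 5} (hD : D.verts = triBall 1) {F : HexVertex} (hF : F ∈ triFacesTouching D.verts) :
    F ∈ hexBall1Faces := by
  rw [hD, triFacesTouching_hexBall1] at hF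
  exact hF

/-! ### The five home-arc lawpoints -/
/-- the face `vHexA = (![0, -2], 1)` at which the lawpoint `zHexA` is read. [cite: KhristoforovSmirnov2021, §2 eq. (4) and Remark 6 (arXiv v1 p. 5)] -/
def vHexA : HexVertex := (![0, -2], 1)

/-- its three sides, tabulated. [cite: BollobasRiordan2006, Ch. 7 Lemma 12 (pp. 206–207)] -/
theorem side_vHexA : side vHexA 0 = s(![0, -1], ![1, -1]) ∧ side vHexA 1 = s(![0, -1], ![1, -2]) ∧ side vHexA 2 = s(![1, -2], ![1, -1]) := by
  unfold side vHexA; decide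

/-- the face `vHexA` has three `H_G`-sides in `hexBall1Five`. [cite: KhristoforovSmirnov2021, §2 Lemma 4 (arXiv v1 p. 4)] -/
theorem allSides_vHexA : AllSides hexBall1Five vHexA := by
  intro i
  have h3 : ∀ i : Fin 3, i = 0 ∨ i = 1 ∨ i = 2 := by decide
  obtain ⟨e0, e1, e2⟩ := side_vHexA
  rcases h3 i with rfl | rfl | rfl
  · rw [e0]; exact mem_hBonds hexBall1Five (by decide +kernel) (by decide +kernel)
  · rw [e1]; exact mem_hBonds hexBall1Five (by decide +kernel) (by decide +kernel)
  · rw [e2]; exact mem_hBonds hexBall1Five (by decide +kernel) (by decide +kernel)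

/-- ★ **the lawpoint `zHexA`**: the boundary mid-edge of the dart `((0,-1),(1,-2))` of the home arc `A_4` of `hexBall1Five`, read at the face `vHexA` (side `1`; the face
across, `(![0, -2], 0)`, is not a corner either). [cite: KhristoforovSmirnov2021, §2 eq. (4) and Remark 6 (arXiv v1 p. 5: `z ∈ u_{j−1}u_{j+1}`); BollobasRiordan2006, Ch. 7 §7.2.2 pp. 191–195] -/
def zHexA : ArcPoint hexBall1Five (Fin.last 4) where
  v := vHexA
  i := 1
  allSides := allSides_vHexA
  not_corner := by rw [corners_hexBall1Five]; unfold vHexA FivePoint.S0.cornerT; decide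
  opp_not_corner := by rw [corners_hexBall1Five]; unfold vHexA FivePoint.S0.cornerT; decide
  g := ![0, -1]
  o := ![1, -2]
  side_eq := by unfold side vHexA; decide
  mem_stretch := by decide

/-- the face `vHexB = (![0, -2], 1)` at which the lawpoint `zHexB` is read. [cite: KhristoforovSmirnov2021, §2 eq. (4) and Remark 6 (arXiv v1 p. 5)] -/
def vHexB : HexVertex := (![0, -2], 1)

/-- its three sides, tabulated. [cite: BollobasRiordan2006, Ch. 7 Lemma 12 (pp. 206–207)] -/
theorem side_vHexB : side vHexB 0 = s(![0, -1], ![1, -1]) ∧ side vHexB 1 = s(![0, -1], ![1, -2]) ∧ side vHexB 2 = s(![1, -2], ![1, -1]) := by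
  unfold side vHexB; decide

/-- the face `vHexB` has three `H_G`-sides in `hexBall1Five`. [cite: KhristoforovSmirnov2021, §2 Lemma 4 (arXiv v1 p. 4)] -/
theorem allSides_vHexB : AllSides hexBall1Five vHexB := by
  intro i
  have h3 : ∀ i : Fin 3, i = 0 ∨ i = 1 ∨ i = 2 := by decide
  obtain ⟨e0, e1, e2⟩ := side_vHexB
  rcases h3 i with rfl | rfl | rfl
  · rw [e0]; exact mem_hBonds hexBall1Five (by decide +kernel) (by decide +kernel)
  · rw [e1]; exact mem_hBonds hexBall1Five (by decide +kernel) (by decide +kernel)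
  · rw [e2]; exact mem_hBonds hexBall1Five (by decide +kernel) (by decide +kernel)

/-- ★ **the lawpoint `zHexB`**: the boundary mid-edge of the dart `((1,-1),(1,-2))` of the home arc `A_4` of `hexBall1Five`, read at the face `vHexB` (side `2`; the face
across, `(![1, -2], 0)`, is not a corner either). [cite: KhristoforovSmirnov2021, §2 eq. (4) and Remark 6 (arXiv v1 p. 5: `z ∈ u_{j−1}u_{j+1}`); BollobasRiordan2006, Ch. 7 §7.2.2 pp. 191–195] -/
def zHexB : ArcPoint hexBall1Five (Fin.last 4) where
  v := vHexB
  i := 2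
  allSides := allSides_vHexB
  not_corner := by rw [corners_hexBall1Five]; unfold vHexB FivePoint.S0.cornerT; decide
  opp_not_corner := by rw [corners_hexBall1Five]; unfold vHexB FivePoint.S0.cornerT; decide
  g := ![1, -1]
  o := ![1, -2]
  side_eq := by unfold side vHexB; decide
  mem_stretch := by decide

/-- the face `vHexC = (![1, -1], 0)` at which the lawpoint `zHexC` is read. [cite: KhristoforovSmirnov2021, §2 eq. (4) and Remark 6 (arXiv v1 p. 5)] -/
def vHexC : HexVertex := (![1, -1], 0)

/-- its three sides, tabulated. [cite: BollobasRiordan2006, Ch. 7 Lemma 12 (pp. 206–207)] -/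
theorem side_vHexC : side vHexC 0 = s(![1, 0], ![2, -1]) ∧ side vHexC 1 = s(![1, -1], ![1, 0]) ∧ side vHexC 2 = s(![1, -1], ![2, -1]) := by
  unfold side vHexC; decide

/-- the face `vHexC` has three `H_G`-sides in `hexBall1FiveW`. [cite: KhristoforovSmirnov2021, §2 Lemma 4 (arXiv v1 p. 4)] -/
theorem allSides_vHexC : AllSides hexBall1FiveW vHexC := by
  intro i
  have h3 : ∀ i : Fin 3, i = 0 ∨ i = 1 ∨ i = 2 := by decide
  obtain ⟨e0, e1, e2⟩ := side_vHexC
  rcases h3 i with rfl | rfl | rfl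
  · rw [e0]; exact mem_hBonds hexBall1FiveW (by decide +kernel) (by decide +kernel)
  · rw [e1]; exact mem_hBonds hexBall1FiveW (by decide +kernel) (by decide +kernel)
  · rw [e2]; exact mem_hBonds hexBall1FiveW (by decide +kernel) (by decide +kernel)

/-- ★ **the lawpoint `zHexC`**: the boundary mid-edge of the dart `((1,-1),(2,-1))` of the home arc `A_4` of `hexBall1FiveW`, read at the face `vHexC` (side `2`; the face
across, `(![1, -2], 1)`, is not a corner either). [cite: KhristoforovSmirnov2021, §2 eq. (4) and Remark 6 (arXiv v1 p. 5: `z ∈ u_{j−1}u_{j+1}`); BollobasRiordan2006, Ch. 7 §7.2.2 pp. 191–195] -/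
def zHexC : ArcPoint hexBall1FiveW (Fin.last 4) where
  v := vHexC
  i := 2
  allSides := allSides_vHexC
  not_corner := by rw [corners_hexBall1FiveW]; unfold vHexC hexCornerW; decide
  opp_not_corner := by rw [corners_hexBall1FiveW]; unfold vHexC hexCornerW; decide
  g := ![1, -1]
  o := ![2, -1]
  side_eq := by unfold side vHexC; decide
  mem_stretch := by decide

/-- the face `vHexD = (![1, -1], 0)` at which the lawpoint `zHexD` is read. [cite: KhristoforovSmirnov2021, §2 eq. (4) and Remark 6 (arXiv v1 p. 5)] -/
def vHexD : HexVertex := (![1, -1], 0)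

/-- its three sides, tabulated. [cite: BollobasRiordan2006, Ch. 7 Lemma 12 (pp. 206–207)] -/
theorem side_vHexD : side vHexD 0 = s(![1, 0], ![2, -1]) ∧ side vHexD 1 = s(![1, -1], ![1, 0]) ∧ side vHexD 2 = s(![1, -1], ![2, -1]) := by
  unfold side vHexD; decide

/-- the face `vHexD` has three `H_G`-sides in `hexBall1FiveNW`. [cite: KhristoforovSmirnov2021, §2 Lemma 4 (arXiv v1 p. 4)] -/
theorem allSides_vHexD : AllSides hexBall1FiveNW vHexD := by
  intro i
  have h3 : ∀ i : Fin 3, i = 0 ∨ i = 1 ∨ i = 2 := by decide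
  obtain ⟨e0, e1, e2⟩ := side_vHexD
  rcases h3 i with rfl | rfl | rfl
  · rw [e0]; exact mem_hBonds hexBall1FiveNW (by decide +kernel) (by decide +kernel)
  · rw [e1]; exact mem_hBonds hexBall1FiveNW (by decide +kernel) (by decide +kernel)
  · rw [e2]; exact mem_hBonds hexBall1FiveNW (by decide +kernel) (by decide +kernel)

/-- ★ **the lawpoint `zHexD`**: the boundary mid-edge of the dart `((1,-1),(2,-1))` of the home arc `A_4` of `hexBall1FiveNW`, read at the face `vHexD` (side `2`; the face
across, `(![1, -2], 1)`, is not a corner either). [cite: KhristoforovSmirnov2021, §2 eq. (4) and Remark 6 (arXiv v1 p. 5: `z ∈ u_{j−1}u_{j+1}`); BollobasRiordan2006, Ch. 7 §7.2.2 pp. 191–195] -/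
def zHexD : ArcPoint hexBall1FiveNW (Fin.last 4) where
  v := vHexD
  i := 2
  allSides := allSides_vHexD
  not_corner := by rw [corners_hexBall1FiveNW]; unfold vHexD hexCornerNW; decide
  opp_not_corner := by rw [corners_hexBall1FiveNW]; unfold vHexD hexCornerNW; decide
  g := ![1, -1]
  o := ![2, -1]
  side_eq := by unfold side vHexD; decide
  mem_stretch := by decide

/-- the face `vHexE = (![1, -1], 0)` at which the lawpoint `zHexE` is read. [cite: KhristoforovSmirnov2021, §2 eq. (4) and Remark 6 (arXiv v1 p. 5)] -/
def vHexE : HexVertex := (![1, -1], 0)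

/-- its three sides, tabulated. [cite: BollobasRiordan2006, Ch. 7 Lemma 12 (pp. 206–207)] -/
theorem side_vHexE : side vHexE 0 = s(![1, 0], ![2, -1]) ∧ side vHexE 1 = s(![1, -1], ![1, 0]) ∧ side vHexE 2 = s(![1, -1], ![2, -1]) := by
  unfold side vHexE; decide

/-- the face `vHexE` has three `H_G`-sides in `hexBall1FiveNE`. [cite: KhristoforovSmirnov2021, §2 Lemma 4 (arXiv v1 p. 4)] -/
theorem allSides_vHexE : AllSides hexBall1FiveNE vHexE := by
  intro i
  have h3 : ∀ i : Fin 3, i = 0 ∨ i = 1 ∨ i = 2 := by decide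
  obtain ⟨e0, e1, e2⟩ := side_vHexE
  rcases h3 i with rfl | rfl | rfl
  · rw [e0]; exact mem_hBonds hexBall1FiveNE (by decide +kernel) (by decide +kernel)
  · rw [e1]; exact mem_hBonds hexBall1FiveNE (by decide +kernel) (by decide +kernel)
  · rw [e2]; exact mem_hBonds hexBall1FiveNE (by decide +kernel) (by decide +kernel)

/-- ★ **the lawpoint `zHexE`**: the boundary mid-edge of the dart `((1,-1),(2,-1))` of the home arc `A_4` of `hexBall1FiveNE`, read at the face `vHexE` (side `2`; the face
across, `(![1, -2], 1)`, is not a corner either). [cite: KhristoforovSmirnov2021, §2 eq. (4) and Remark 6 (arXiv v1 p. 5: `z ∈ u_{j−1}u_{j+1}`); BollobasRiordan2006, Ch. 7 §7.2.2 pp. 191–195] -/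
def zHexE : ArcPoint hexBall1FiveNE (Fin.last 4) where
  v := vHexE
  i := 2
  allSides := allSides_vHexE
  not_corner := by rw [corners_hexBall1FiveNE]; unfold vHexE hexCornerNE; decide
  opp_not_corner := by rw [corners_hexBall1FiveNE]; unfold vHexE hexCornerNE; decide
  g := ![1, -1]
  o := ![2, -1]
  side_eq := by unfold side vHexE; decide
  mem_stretch := by decide

end Literature.Probability.Percolation.MarkedLoops
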